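/-
Copyright (c) 2026. All rights reserved.
Released under Apache 2.0 license as described in the file LICENSE.
-/
import Literature.AlgebraicGeometry.GroupSchemes.KernelIdealSpecialFibre
import Mathlib.RingTheory.LocalRing.Module
import Mathlib.RingTheory.LocalRing.ResidueField.Basic
import Mathlib.LinearAlgebra.TensorProduct.RightExactness
import Mathlib.RingTheory.TensorProduct.Basic
import Mathlib.RingTheory.Flat.Basic
import Mathlib.LinearAlgebra.Dimension.Constructions
import Mathlib.LinearAlgebra.FiniteDimensional.Lemmas

/-!
# Flatness of the kernel of a homomorphism of finite group schemes from a fibre-rank inequality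

The one non-structural hypothesis of `KernelIdealSpecialFibre` ED. 2
(`spI_map_ker_counit_pullback_eq … [Module.Flat R (Γ(G₁) ⧸ J(φ))]`, "the kernel `Ker φ = Spec (Γ(G₁) ⧸ J(φ))` is
`R`-flat") is discharged by a RANK TEST over a local base `(R, 𝔪, k)`:

* §1 (commutative algebra, Mathlib-only). A finite `R`-module `M` over a local ring `R` whose special fibre has
  dimension at most that of its fibre over a field `K` into which `R` injects,
  `dim_k (k ⊗_R M) ≤ dim_K (K ⊗_R M)`, is FREE of that rank (Nakayama gives `R^r ↠ M`, `r = dim_k`, and a surjection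
  `K^r ↠ K ⊗_R M` onto a space of dimension `≥ r` is injective, whence so is `R^r → M` because `R^r ↪ K ⊗_R R^r`);
  the same with `k` replaced by any field `κ` through which the residue map factors (`𝔪 ↦ 0`).
  [cite: AtiyahMacdonald1969, Prop. 2.8] [cite: EGAIV2, Prop. 2.8.5]
* §2 (group schemes). For a homomorphism `φ : G₁ → G₂` of affine group schemes over `R` with `Γ(G₁)` module-finite,
  the fibres of `Γ(G₁) ⧸ J(φ)` are the kernel algebras `Γ((G₁)_κ) ⧸ J(φ_κ)` and `Γ((G₁)_K) ⧸ J(φ_K)`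
  (`KernelIdealSpecialFibre` §2), so "ORDER OF THE SPECIAL KERNEL ≤ ORDER OF THE GENERIC KERNEL" makes
  `Γ(G₁) ⧸ J(φ)` free, hence flat, and ED. 2's specialisation identity `spI (J(φ_K)) = J(φ_κ)` holds outright.
  [cite: Tate1997FiniteFlatGroupSchemes, (3.7)] [cite: EGAIV2, Prop. 2.8.5]
-/

noncomputable section

universe u v w

open TensorProduct Module

namespace Literature.RingTheory.Flat

/-! ## §1 A finite module over a local ring with `dim (special fibre) ≤ dim (generic fibre)` is free -/

section FibreRank

variable {R : Type u} [CommRing R] [IsLocalRing R] (K : Type v) [Field K] [Algebra R K]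
  (M : Type w) [AddCommGroup M] [Module R M] [Module.Finite R M]

open IsLocalRing

/-- **§1 HEAD — FREE FROM THE FIBRE-RANK INEQUALITY.** `R` local with residue field `k`, `R ↪ K` a field, `M` a finite
`R`-module with `dim_k (k ⊗_R M) ≤ dim_K (K ⊗_R M)`: then `M ≅ R^r`, `r = dim_k (k ⊗_R M)`.
Proof: Nakayama (`IsLocalRing.span_eq_top_of_tmul_eq_basis`) gives `π : R^r ↠ M`; `K ⊗ π : K^r ↠ K ⊗_R M` is then a
surjection onto a space of dimension `≥ r`, hence injective; and `x ↦ 1 ⊗ x : R^r → K ⊗_R R^r` is injective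
(`Algebra.TensorProduct.includeRight_injective`), so `π` is injective. [cite: AtiyahMacdonald1969, Prop. 2.8] [cite: EGAIV2, Prop. 2.8.5] -/
theorem nonempty_pi_linearEquiv_of_finrank_residueField_tensor_le (hK : Function.Injective (algebraMap R K))
    (h : finrank (ResidueField R) (ResidueField R ⊗[R] M) ≤ finrank K (K ⊗[R] M)) :
    Nonempty ((Fin (finrank (ResidueField R) (ResidueField R ⊗[R] M)) → R) ≃ₗ[R] M) := by
  set r := finrank (ResidueField R) (ResidueField R ⊗[R] M)
  let b : Basis (Fin r) (ResidueField R) (ResidueField R ⊗[R] M) := Module.finBasis _ _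
  have hsurj : Function.Surjective (TensorProduct.mk R (ResidueField R) M 1) :=
    TensorProduct.mk_surjective R M (ResidueField R) Ideal.Quotient.mk_surjective
  choose f hf using fun i => hsurj (b i)
  have hspan : Submodule.span R (Set.range f) = ⊤ :=
    IsLocalRing.span_eq_top_of_tmul_eq_basis f b fun i => hf i
  let π : (Fin r → R) →ₗ[R] M := Fintype.linearCombination R f
  have hπ : Function.Surjective π := by
    rw [← LinearMap.range_eq_top, Fintype.range_linearCombination, hspan]
  have hcoe : ⇑(π.baseChange K) = ⇑(π.lTensor K) := LinearMap.baseChange_eq_ltensor π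
  have hπK : Function.Surjective (π.baseChange K) := by
    rw [hcoe]; exact LinearMap.lTensor_surjective K hπ
  have hfin : finrank K (K ⊗[R] (Fin r → R)) = r := by
    rw [Module.finrank_baseChange, Module.finrank_fin_fun]
  have hle : finrank K (K ⊗[R] M) ≤ r := by
    have h1 := LinearMap.finrank_range_le (π.baseChange K)
    rwa [LinearMap.range_eq_top.mpr hπK, finrank_top, hfin] at h1
  have hinjK : Function.Injective (π.baseChange K) :=
    (LinearMap.injective_iff_surjective_of_finrank_eq_finrank (hfin.trans (le_antisymm h hle))).mpr hπK
  have hinj : Function.Injective π := by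
    intro x y hxy
    have h1 : π.baseChange K ((1 : K) ⊗ₜ[R] x) = π.baseChange K ((1 : K) ⊗ₜ[R] y) := by
      simp only [LinearMap.baseChange_tmul, hxy]
    have h2 : (1 : K) ⊗ₜ[R] x = (1 : K) ⊗ₜ[R] y := hinjK h1
    exact Algebra.TensorProduct.includeRight_injective (A := K) (B := Fin r → R) hK h2
  exact ⟨LinearEquiv.ofBijective π ⟨hinj, hπ⟩⟩

/-- **§1 — free.** Under the fibre-rank inequality `M` is free. [cite: AtiyahMacdonald1969, Prop. 2.8] [cite: EGAIV2, Prop. 2.8.5] -/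
theorem free_of_finrank_residueField_tensor_le (hK : Function.Injective (algebraMap R K))
    (h : finrank (ResidueField R) (ResidueField R ⊗[R] M) ≤ finrank K (K ⊗[R] M)) : Module.Free R M := by
  obtain ⟨e⟩ := nonempty_pi_linearEquiv_of_finrank_residueField_tensor_le K M hK h
  exact Module.Free.of_equiv e

/-- **§1 — flat.** Under the fibre-rank inequality `M` is flat. [cite: AtiyahMacdonald1969, Prop. 2.8] [cite: EGAIV2, Prop. 2.8.5] -/
theorem flat_of_finrank_residueField_tensor_le (hK : Function.Injective (algebraMap R K))
    (h : finrank (ResidueField R) (ResidueField R ⊗[R] M) ≤ finrank K (K ⊗[R] M)) : Module.Flat R M := by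
  haveI := free_of_finrank_residueField_tensor_le K M hK h
  infer_instance

/-- **§1 — the rank.** Under the fibre-rank inequality `rank_R M = dim_k (k ⊗_R M) = dim_K (K ⊗_R M)`.
[cite: AtiyahMacdonald1969, Prop. 2.8] -/
theorem finrank_eq_of_finrank_residueField_tensor_le (hK : Function.Injective (algebraMap R K))
    (h : finrank (ResidueField R) (ResidueField R ⊗[R] M) ≤ finrank K (K ⊗[R] M)) :
    finrank R M = finrank (ResidueField R) (ResidueField R ⊗[R] M) ∧
      finrank K (K ⊗[R] M) = finrank (ResidueField R) (ResidueField R ⊗[R] M) := by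
  obtain ⟨e⟩ := nonempty_pi_linearEquiv_of_finrank_residueField_tensor_le K M hK h
  haveI : Module.Free R M := Module.Free.of_equiv e
  have h1 : finrank R M = finrank (ResidueField R) (ResidueField R ⊗[R] M) := by
    rw [← e.finrank_eq, Module.finrank_fin_fun]
  exact ⟨h1, by rw [Module.finrank_baseChange, h1]⟩

variable (κ : Type w) [Field κ] [Algebra R κ]

/-- **Any residue-type field.** If the structure map `R → κ` to a field kills `𝔪`, then
`dim_κ (κ ⊗_R M) = dim_k (k ⊗_R M)` (`κ ⊗_R M = κ ⊗_k (k ⊗_R M)`). [cite: AtiyahMacdonald1969, Prop. 2.8] -/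
theorem finrank_tensor_eq_finrank_residueField_tensor {M : Type*} [AddCommGroup M] [Module R M]
    (hκ : IsLocalRing.maximalIdeal R ≤ RingHom.ker (algebraMap R κ)) :
    finrank κ (κ ⊗[R] M) = finrank (ResidueField R) (ResidueField R ⊗[R] M) := by
  letI : Algebra (ResidueField R) κ :=
    (Ideal.Quotient.lift (IsLocalRing.maximalIdeal R) (algebraMap R κ) fun a ha => hκ ha).toAlgebra
  haveI : IsScalarTower R (ResidueField R) κ :=
    IsScalarTower.of_algebraMap_eq fun x => (Ideal.Quotient.lift_mk (IsLocalRing.maximalIdeal R) (algebraMap R κ) _).symm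
  rw [← (TensorProduct.AlgebraTensorModule.cancelBaseChange R (ResidueField R) κ κ M).finrank_eq,
    Module.finrank_baseChange]

/-- **§1 HEAD′ — FREE FROM THE FIBRE-RANK INEQUALITY AT ANY RESIDUE-TYPE FIELD**: `R` local, `R → κ` a field killing `𝔪`,
`R ↪ K` a field, `M` finite with `dim_κ (κ ⊗_R M) ≤ dim_K (K ⊗_R M)` ⇒ `M` is free (and flat, of rank `dim_κ (κ ⊗_R M)`).
[cite: AtiyahMacdonald1969, Prop. 2.8] [cite: EGAIV2, Prop. 2.8.5] -/
theorem free_of_finrank_tensor_le (hκ : IsLocalRing.maximalIdeal R ≤ RingHom.ker (algebraMap R κ))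
    (hK : Function.Injective (algebraMap R K)) (h : finrank κ (κ ⊗[R] M) ≤ finrank K (K ⊗[R] M)) :
    Module.Free R M :=
  free_of_finrank_residueField_tensor_le K M hK ((finrank_tensor_eq_finrank_residueField_tensor κ hκ).symm.le.trans h)

/-- **§1 — flat, any residue-type field.** [cite: AtiyahMacdonald1969, Prop. 2.8] [cite: EGAIV2, Prop. 2.8.5] -/
theorem flat_of_finrank_tensor_le (hκ : IsLocalRing.maximalIdeal R ≤ RingHom.ker (algebraMap R κ))
    (hK : Function.Injective (algebraMap R K)) (h : finrank κ (κ ⊗[R] M) ≤ finrank K (K ⊗[R] M)) :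
    Module.Flat R M := by
  haveI := free_of_finrank_tensor_le K M κ hκ hK h
  infer_instance

/-- **§1 — equality of the fibre ranks, any residue-type field**: under the inequality the two fibre dimensions agree
(and equal `rank_R M`). [cite: AtiyahMacdonald1969, Prop. 2.8] -/
theorem finrank_tensor_eq_of_finrank_tensor_le (hκ : IsLocalRing.maximalIdeal R ≤ RingHom.ker (algebraMap R κ))
    (hK : Function.Injective (algebraMap R K)) (h : finrank κ (κ ⊗[R] M) ≤ finrank K (K ⊗[R] M)) :
    finrank K (K ⊗[R] M) = finrank κ (κ ⊗[R] M) ∧ finrank R M = finrank κ (κ ⊗[R] M) := by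
  have hκk := finrank_tensor_eq_finrank_residueField_tensor κ (M := M) hκ
  obtain ⟨h1, h2⟩ := finrank_eq_of_finrank_residueField_tensor_le K M hK (hκk.symm.le.trans h)
  exact ⟨h2.trans hκk.symm, h1.trans hκk.symm⟩

end FibreRank

end Literature.RingTheory.Flat

/-! ## §2 Group schemes: the kernel `Spec (Γ(G₁) ⧸ J(φ))` is flat when the special kernel is not bigger than the generic one -/

open CategoryTheory CategoryTheory.Limits AlgebraicGeometry MonoidalCategory CartesianMonoidalCategory

namespace Literature.AlgebraicGeometry.GroupSchemes

namespace AffineGroupScheme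

open scoped MonObj CategoryTheory.Obj
open Literature.AlgebraicGeometry.Motives GroupSchemeKernel

section FlatOfRank

variable {R : Type u} [CommRing R]

/-- **Base change of a quotient algebra**: `S ⊗_R (A ⧸ J) ≅ (S ⊗_R A) ⧸ J·(S ⊗_R A)` as `S`-algebras (right exactness of
`S ⊗_R −`, Mathlib `Algebra.TensorProduct.lTensor_ker`). [cite: AtiyahMacdonald1969, Prop. 2.8] [cite: EGAIV2, Prop. 2.8.5] -/
theorem nonempty_tensor_quotient_algEquiv (S : Type u) [CommRing S] [Algebra R S] {A : Type u} [CommRing A] [Algebra R A]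
    (J : Ideal A) :
    Nonempty ((S ⊗[R] (A ⧸ J)) ≃ₐ[S] (S ⊗[R] A) ⧸ J.map (Algebra.TensorProduct.includeRight : A →ₐ[R] S ⊗[R] A)) := by
  have hsurj : Function.Surjective (Algebra.TensorProduct.map (AlgHom.id S S) (Ideal.Quotient.mkₐ R J)) := by
    intro z
    induction z with
    | zero => exact ⟨0, map_zero _⟩
    | tmul s a =>
      obtain ⟨a', rfl⟩ := Ideal.Quotient.mkₐ_surjective R J a
      exact ⟨s ⊗ₜ a', by rw [Algebra.TensorProduct.map_tmul, AlgHom.id_apply]⟩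
    | add x y hx hy =>
      obtain ⟨x', rfl⟩ := hx
      obtain ⟨y', rfl⟩ := hy
      exact ⟨x' + y', map_add _ _ _⟩
  have hker : RingHom.ker (Algebra.TensorProduct.map (AlgHom.id S S) (Ideal.Quotient.mkₐ R J)) =
      J.map (Algebra.TensorProduct.includeRight : A →ₐ[R] S ⊗[R] A) := by
    have h1 := Algebra.TensorProduct.lTensor_ker (A := S) (Ideal.Quotient.mkₐ R J) (Ideal.Quotient.mkₐ_surjective R J)
    have h2 : RingHom.ker (Ideal.Quotient.mkₐ R J) = J := by
      ext a
      rw [RingHom.mem_ker, Ideal.Quotient.mkₐ_eq_mk, Ideal.Quotient.eq_zero_iff_mem]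
    rw [h2] at h1
    rw [← h1]
    ext x
    exact Iff.rfl
  exact ⟨(Ideal.quotientKerAlgEquivOfSurjective hsurj).symm.trans (Ideal.quotientEquivAlgOfEq S hker)⟩

/-- **finrank form**: `dim_S (S ⊗_R (A ⧸ J)) = dim_S ((S ⊗_R A) ⧸ J·(S ⊗_R A))`. [cite: EGAIV2, Prop. 2.8.5] -/
theorem finrank_tensor_quotient_eq (S : Type u) [CommRing S] [Algebra R S] {A : Type u} [CommRing A] [Algebra R A]
    (J : Ideal A) :
    Module.finrank S (S ⊗[R] (A ⧸ J)) =
      Module.finrank S ((S ⊗[R] A) ⧸ J.map (Algebra.TensorProduct.includeRight : A →ₐ[R] S ⊗[R] A)) := by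
  obtain ⟨e⟩ := nonempty_tensor_quotient_algEquiv (R := R) S J
  exact e.toLinearEquiv.finrank_eq

variable (K κ : Type u) [Field K] [Algebra R K] [Field κ] [Algebra R κ]
  {G₁ G₂ : SchemeOver R} [GrpObj G₁] [GrpObj G₂] [IsAffine G₁.left] [IsAffine G₂.left] (φ : G₁ ⟶ G₂)
  [IsAffine ((Over.pullback (Spec.map (CommRingCat.ofHom (algebraMap R K)))).obj G₁).left]
  [IsAffine ((Over.pullback (Spec.map (CommRingCat.ofHom (algebraMap R κ)))).obj G₁).left]
  [IsAffine ((Over.pullback (Spec.map (CommRingCat.ofHom (algebraMap R K)))).obj G₂).left]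
  [IsAffine ((Over.pullback (Spec.map (CommRingCat.ofHom (algebraMap R κ)))).obj G₂).left]

/-- **THE FIBRES OF `Γ(G₁) ⧸ J(φ)` ARE THE KERNEL ALGEBRAS OF THE FIBRES**: for every base change `R → S`,
`Γ((G₁)_S) ⧸ J(φ_S) ≅ S ⊗_R (Γ(G₁) ⧸ J(φ))` as `S`-algebras (`KernelIdealSpecialFibre` §2 `J(φ_S) = e_S⁻¹(J(φ)·(S ⊗ Γ(G₁)))`
+ right exactness). [cite: Tate1997FiniteFlatGroupSchemes, (3.7)] [cite: EGAIV2, Prop. 2.8.5] -/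
theorem nonempty_quotient_map_ker_counit_pullback_algEquiv [IsMonHom φ] (S : Type u) [CommRing S] [Algebra R S]
    [IsAffine ((Over.pullback (Spec.map (CommRingCat.ofHom (algebraMap R S)))).obj G₁).left]
    [IsAffine ((Over.pullback (Spec.map (CommRingCat.ofHom (algebraMap R S)))).obj G₂).left] :
    Nonempty ((Alg ((Over.pullback (Spec.map (CommRingCat.ofHom (algebraMap R S)))).obj G₁) ⧸
        (RingHom.ker (Bialgebra.counitAlgHom S
            (Alg ((Over.pullback (Spec.map (CommRingCat.ofHom (algebraMap R S)))).obj G₂)))).map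
          (Alg.comap ((Over.pullback (Spec.map (CommRingCat.ofHom (algebraMap R S)))).map φ))) ≃ₐ[S]
      S ⊗[R] (Alg G₁ ⧸ (RingHom.ker (Bialgebra.counitAlgHom R (Alg G₂))).map (Alg.comap φ))) := by
  obtain ⟨e⟩ := nonempty_tensor_quotient_algEquiv (R := R) S ((RingHom.ker (Bialgebra.counitAlgHom R (Alg G₂))).map (Alg.comap φ))
  have hIJ : ((RingHom.ker (Bialgebra.counitAlgHom R (Alg G₂))).map (Alg.comap φ)).map
        (Algebra.TensorProduct.includeRight : Alg G₁ →ₐ[R] S ⊗[R] Alg G₁) =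
      ((RingHom.ker (Bialgebra.counitAlgHom S
            (Alg ((Over.pullback (Spec.map (CommRingCat.ofHom (algebraMap R S)))).obj G₂)))).map
          (Alg.comap ((Over.pullback (Spec.map (CommRingCat.ofHom (algebraMap R S)))).map φ))).map
        ((algBaseChangeEquiv S G₁ : _ ≃ₐ[S] S ⊗[R] Alg G₁) : _ →+* S ⊗[R] Alg G₁) := by
    rw [← comap_algBaseChangeEquiv_map_includeRight_map_ker_counit_eq φ S]
    exact (Ideal.map_comap_of_surjective _ (algBaseChangeEquiv S G₁).surjective _).symm
  exact ⟨(Ideal.quotientEquivAlg _ _ (algBaseChangeEquiv S G₁) hIJ).trans e.symm⟩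

/-- **finrank form**: `dim_S (Γ((G₁)_S) ⧸ J(φ_S)) = dim_S (S ⊗_R (Γ(G₁) ⧸ J(φ)))`.
[cite: Tate1997FiniteFlatGroupSchemes, (3.7)] -/
theorem finrank_quotient_map_ker_counit_pullback_eq [IsMonHom φ] (S : Type u) [CommRing S] [Algebra R S]
    [IsAffine ((Over.pullback (Spec.map (CommRingCat.ofHom (algebraMap R S)))).obj G₁).left]
    [IsAffine ((Over.pullback (Spec.map (CommRingCat.ofHom (algebraMap R S)))).obj G₂).left] :
    Module.finrank S (Alg ((Over.pullback (Spec.map (CommRingCat.ofHom (algebraMap R S)))).obj G₁) ⧸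
        (RingHom.ker (Bialgebra.counitAlgHom S
            (Alg ((Over.pullback (Spec.map (CommRingCat.ofHom (algebraMap R S)))).obj G₂)))).map
          (Alg.comap ((Over.pullback (Spec.map (CommRingCat.ofHom (algebraMap R S)))).map φ))) =
      Module.finrank S (S ⊗[R] (Alg G₁ ⧸ (RingHom.ker (Bialgebra.counitAlgHom R (Alg G₂))).map (Alg.comap φ))) := by
  obtain ⟨e⟩ := nonempty_quotient_map_ker_counit_pullback_algEquiv φ S
  exact e.toLinearEquiv.finrank_eq

variable [IsLocalRing R]

/-- **§2 HEAD — THE KERNEL IS FLAT WHEN THE SPECIAL KERNEL IS NOT BIGGER THAN THE GENERIC ONE.** `R` local, `R → κ` a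
field killing `𝔪` (e.g. `κ = k̄`), `R ↪ K` a field (e.g. an algebraic closure of `Frac R`), `Γ(G₁)` a finite `R`-module,
`φ : G₁ → G₂` a homomorphism of affine group schemes; if `dim_κ Γ(Ker φ_κ) ≤ dim_K Γ(Ker φ_K)` then `Γ(Ker φ) = Γ(G₁) ⧸ J(φ)`
is `R`-free, in particular `R`-flat — §1 HEAD′ on the fibre identifications above.
[cite: Tate1997FiniteFlatGroupSchemes, (3.7)] [cite: EGAIV2, Prop. 2.8.5] -/
theorem free_quotient_map_ker_counit_of_finrank_le [IsMonHom φ] [Module.Finite R (Alg G₁)]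
    (hκ : IsLocalRing.maximalIdeal R ≤ RingHom.ker (algebraMap R κ)) (hK : Function.Injective (algebraMap R K))
    (h : Module.finrank κ (Alg ((Over.pullback (Spec.map (CommRingCat.ofHom (algebraMap R κ)))).obj G₁) ⧸
          (RingHom.ker (Bialgebra.counitAlgHom κ
              (Alg ((Over.pullback (Spec.map (CommRingCat.ofHom (algebraMap R κ)))).obj G₂)))).map
            (Alg.comap ((Over.pullback (Spec.map (CommRingCat.ofHom (algebraMap R κ)))).map φ))) ≤
        Module.finrank K (Alg ((Over.pullback (Spec.map (CommRingCat.ofHom (algebraMap R K)))).obj G₁) ⧸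
          (RingHom.ker (Bialgebra.counitAlgHom K
              (Alg ((Over.pullback (Spec.map (CommRingCat.ofHom (algebraMap R K)))).obj G₂)))).map
            (Alg.comap ((Over.pullback (Spec.map (CommRingCat.ofHom (algebraMap R K)))).map φ)))) :
    Module.Free R (Alg G₁ ⧸ (RingHom.ker (Bialgebra.counitAlgHom R (Alg G₂))).map (Alg.comap φ)) := by
  haveI : Module.Finite R (Alg G₁ ⧸ (RingHom.ker (Bialgebra.counitAlgHom R (Alg G₂))).map (Alg.comap φ)) :=
    Module.Finite.of_surjective (Ideal.Quotient.mkₐ R _).toLinearMap (Ideal.Quotient.mkₐ_surjective R _)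
  refine Literature.RingTheory.Flat.free_of_finrank_tensor_le K _ κ hκ hK ?_
  rw [← finrank_quotient_map_ker_counit_pullback_eq φ κ, ← finrank_quotient_map_ker_counit_pullback_eq φ K]
  exact h

/-- **§2 — flat.** Same hypotheses ⇒ `Γ(G₁) ⧸ J(φ)` is `R`-flat (the instance `KernelIdealSpecialFibre` ED. 2 asks for).
[cite: Tate1997FiniteFlatGroupSchemes, (3.7)] [cite: EGAIV2, Prop. 2.8.5] -/
theorem flat_quotient_map_ker_counit_of_finrank_le [IsMonHom φ] [Module.Finite R (Alg G₁)]
    (hκ : IsLocalRing.maximalIdeal R ≤ RingHom.ker (algebraMap R κ)) (hK : Function.Injective (algebraMap R K))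
    (h : Module.finrank κ (Alg ((Over.pullback (Spec.map (CommRingCat.ofHom (algebraMap R κ)))).obj G₁) ⧸
          (RingHom.ker (Bialgebra.counitAlgHom κ
              (Alg ((Over.pullback (Spec.map (CommRingCat.ofHom (algebraMap R κ)))).obj G₂)))).map
            (Alg.comap ((Over.pullback (Spec.map (CommRingCat.ofHom (algebraMap R κ)))).map φ))) ≤
        Module.finrank K (Alg ((Over.pullback (Spec.map (CommRingCat.ofHom (algebraMap R K)))).obj G₁) ⧸
          (RingHom.ker (Bialgebra.counitAlgHom K
              (Alg ((Over.pullback (Spec.map (CommRingCat.ofHom (algebraMap R K)))).obj G₂)))).map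
            (Alg.comap ((Over.pullback (Spec.map (CommRingCat.ofHom (algebraMap R K)))).map φ)))) :
    Module.Flat R (Alg G₁ ⧸ (RingHom.ker (Bialgebra.counitAlgHom R (Alg G₂))).map (Alg.comap φ)) := by
  haveI := free_quotient_map_ker_counit_of_finrank_le K κ φ hκ hK h
  infer_instance

/-- **§2 — the kernel orders then AGREE** (`dim_K Γ(Ker φ_K) = dim_κ Γ(Ker φ_κ)`): upper semicontinuity the other way.
[cite: Tate1997FiniteFlatGroupSchemes, (3.7)] [cite: AtiyahMacdonald1969, Prop. 2.8] -/
theorem finrank_ker_generic_eq_special_of_finrank_le [IsMonHom φ] [Module.Finite R (Alg G₁)]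
    (hκ : IsLocalRing.maximalIdeal R ≤ RingHom.ker (algebraMap R κ)) (hK : Function.Injective (algebraMap R K))
    (h : Module.finrank κ (Alg ((Over.pullback (Spec.map (CommRingCat.ofHom (algebraMap R κ)))).obj G₁) ⧸
          (RingHom.ker (Bialgebra.counitAlgHom κ
              (Alg ((Over.pullback (Spec.map (CommRingCat.ofHom (algebraMap R κ)))).obj G₂)))).map
            (Alg.comap ((Over.pullback (Spec.map (CommRingCat.ofHom (algebraMap R κ)))).map φ))) ≤
        Module.finrank K (Alg ((Over.pullback (Spec.map (CommRingCat.ofHom (algebraMap R K)))).obj G₁) ⧸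
          (RingHom.ker (Bialgebra.counitAlgHom K
              (Alg ((Over.pullback (Spec.map (CommRingCat.ofHom (algebraMap R K)))).obj G₂)))).map
            (Alg.comap ((Over.pullback (Spec.map (CommRingCat.ofHom (algebraMap R K)))).map φ)))) :
    Module.finrank K (Alg ((Over.pullback (Spec.map (CommRingCat.ofHom (algebraMap R K)))).obj G₁) ⧸
          (RingHom.ker (Bialgebra.counitAlgHom K
              (Alg ((Over.pullback (Spec.map (CommRingCat.ofHom (algebraMap R K)))).obj G₂)))).map
            (Alg.comap ((Over.pullback (Spec.map (CommRingCat.ofHom (algebraMap R K)))).map φ))) =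
      Module.finrank κ (Alg ((Over.pullback (Spec.map (CommRingCat.ofHom (algebraMap R κ)))).obj G₁) ⧸
          (RingHom.ker (Bialgebra.counitAlgHom κ
              (Alg ((Over.pullback (Spec.map (CommRingCat.ofHom (algebraMap R κ)))).obj G₂)))).map
            (Alg.comap ((Over.pullback (Spec.map (CommRingCat.ofHom (algebraMap R κ)))).map φ))) := by
  haveI : Module.Finite R (Alg G₁ ⧸ (RingHom.ker (Bialgebra.counitAlgHom R (Alg G₂))).map (Alg.comap φ)) :=
    Module.Finite.of_surjective (Ideal.Quotient.mkₐ R _).toLinearMap (Ideal.Quotient.mkₐ_surjective R _)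
  rw [finrank_quotient_map_ker_counit_pullback_eq φ κ, finrank_quotient_map_ker_counit_pullback_eq φ K] at h ⊢
  exact (Literature.RingTheory.Flat.finrank_tensor_eq_of_finrank_tensor_le K _ κ hκ hK h).1

/-- **§2 HEAD′ — `KernelIdealSpecialFibre` ED. 2 WITHOUT THE FLATNESS INSTANCE**: under the rank test,
`spI (J(φ_K)) = J(φ_κ)` — the kernel of the special fibre is the specialisation of the generic kernel.
[cite: EGAIV2, Prop. 2.8.5] [cite: Tate1997FiniteFlatGroupSchemes, (3.7)] -/
theorem spI_map_ker_counit_pullback_eq_of_finrank_le [IsMonHom φ] [Module.Finite R (Alg G₁)]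
    (hκ : IsLocalRing.maximalIdeal R ≤ RingHom.ker (algebraMap R κ)) (hK : Function.Injective (algebraMap R K))
    (h : Module.finrank κ (Alg ((Over.pullback (Spec.map (CommRingCat.ofHom (algebraMap R κ)))).obj G₁) ⧸
          (RingHom.ker (Bialgebra.counitAlgHom κ
              (Alg ((Over.pullback (Spec.map (CommRingCat.ofHom (algebraMap R κ)))).obj G₂)))).map
            (Alg.comap ((Over.pullback (Spec.map (CommRingCat.ofHom (algebraMap R κ)))).map φ))) ≤
        Module.finrank K (Alg ((Over.pullback (Spec.map (CommRingCat.ofHom (algebraMap R K)))).obj G₁) ⧸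
          (RingHom.ker (Bialgebra.counitAlgHom K
              (Alg ((Over.pullback (Spec.map (CommRingCat.ofHom (algebraMap R K)))).obj G₂)))).map
            (Alg.comap ((Over.pullback (Spec.map (CommRingCat.ofHom (algebraMap R K)))).map φ)))) :
    spI K κ G₁ ((RingHom.ker (Bialgebra.counitAlgHom K
          (Alg ((Over.pullback (Spec.map (CommRingCat.ofHom (algebraMap R K)))).obj G₂)))).map
        (Alg.comap ((Over.pullback (Spec.map (CommRingCat.ofHom (algebraMap R K)))).map φ))) =
      (RingHom.ker (Bialgebra.counitAlgHom κ (Alg ((Over.pullback (Spec.map (CommRingCat.ofHom (algebraMap R κ)))).obj G₂)))).map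
        (Alg.comap ((Over.pullback (Spec.map (CommRingCat.ofHom (algebraMap R κ)))).map φ)) := by
  haveI := flat_quotient_map_ker_counit_of_finrank_le K κ φ hκ hK h
  exact spI_map_ker_counit_pullback_eq K κ φ hK

end FlatOfRank

end AffineGroupScheme

end Literature.AlgebraicGeometry.GroupSchemes

end
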